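import Literature.Analysis.FluidPDE.CompressibleEulerHomogeneousEnergyDefs
import Literature.Analysis.FluidPDE.CompressibleEulerHomogeneousEnergyBounds
import HarnessLib

/-!
# The homogeneous level-`3` energy inequality for the primitive compressible Euler system on `𝕋³`
# with explicit constants

Analysis/FluidPDE proof file (theorems only; no definitions, no named facts). The DERIVATIVE part
of Majda's `H^m` estimate (Majda 1984, Ch. 2 §2.1, Thm 2.2, (2.38); Kato 1975, Thm II; in
Dafermos' form (5.1.25): `‖∇U(t)‖²_ℓ ≤ c ‖∇U(0)‖²_ℓ exp(c ∫₀ᵗ ‖∇U‖_{L^∞})`) at the level `m = 3`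
for primitive solutions of the non-isentropic compressible Euler equations with the monatomic
law `p = ρϑζ(ρ)` (`IsPrimitiveEulerSolutionOn (monatomicExcess ζ f)`), with ALL constants
explicit in the four inputs

* `c₀ ≤ A, ρ, C ≤ c₁` — two-sided bounds of the symmetriser weights on the state set `K`,
* `Λ ≥ 1` — a bound of `|ρ|, |ϑ|, |A|, |∂A|, |C|, |∂C|, |ζ|, |ζ'|, |D|` on `K` and of the `C¹`
  size `‖u‖, |∇ρ|, ‖∇u‖, |∇ϑ|` of the solution,
* `G ≥ 0` — a bound, on `K`, of the coefficients of all commutator monomials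
  (`CompressibleEulerCommutators.FF/GG/HH`) of the words of length `≤ 3`:

`derivLevelEnergy_three_le`: the derivative-only energy `D₃ = Σ_{1 ≤ |w| ≤ 3} N_w`
(`CompressibleEulerHomogeneousEnergyDefs.derivLevelEnergy`) satisfies

  `D₃(t) ≤ (c₁/c₀) · exp(K_r t) · D₃(0)`,
  `K_r = (L + 18 L² + 273780 · L · G · Λ⁴)/c₀`, `L = 12 Λ³`,

for all `t ∈ [0, T)` — a LINEAR (homogeneous) Grönwall inequality, no additive term, because
for `|w| ≥ 1` every commutator monomial is proper and its `L²` norm is bounded linearly in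
`√D₃` (`CompressibleEulerHomogeneousEnergyBounds.sqrt_integral_list_eval_sq_le_of_le_three`).
The proof is the body of `CompressibleEulerUniformEnergyBounds.levelEnergy_step_of_weights` with
the sums restricted to `1 ≤ |w| ≤ 3`, `ε = 0`, and no Sobolev step (at `m = 3` all sup factors
have order `≤ 1`). The hard-sphere application (constants uniform in the diameter) is elsewhere.

## References

* A. Majda, *Compressible Fluid Flow and Systems of Conservation Laws in Several Space
  Variables*, Springer 1984, Ch. 2 §2.1, Thm 2.2 and (2.38). [Majda1984]
* T. Kato, Arch. Rational Mech. Anal. 58 (1975) 181–205, Thm II. [Kato1975]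
-/

noncomputable section

open Set Function MeasureTheory Filter
open scoped ContDiff Topology

namespace Literature.Analysis.FluidPDE

namespace CompressibleEuler

open Literature.Analysis.FunctionSpaces Literature.Analysis.FunctionSpaces.Torus
open Literature.Analysis.FunctionSpaces.Torus.DiffMonomial

variable {ζ f : ℝ → ℝ}

/-- **The homogeneous level-`3` energy inequality with explicit constants** (Majda 1984, proof
of Thm 2.2, eq. (2.38), derivative part; Kato 1975, Thm II). Let `K` be a set of states on which
the symmetriser weights satisfy `c₀ ≤ A, ρ, C ≤ c₁` (`c₀ > 0`), the eleven state functions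
`ρ, ϑ, A, ∂_ρA, ∂_ϑA, C, ∂_ρC, ∂_ϑC, ζ, ζ', D` are bounded by `Λ ≥ 1`, and the coefficients of
all commutator monomials of the words of length `≤ 3` are bounded by `G`. Then every primitive
solution on `[0, T)` with state in `K` and `C¹` size `≤ Λ` satisfies
`D₃(t) ≤ (c₁/c₀) exp(K_r t) D₃(0)` for `t ∈ [0, T)`, with the explicit rate
`K_r = (12Λ³ + 18(12Λ³)² + 273780 · 12Λ³ · G · Λ⁴)/c₀`.
[cite: Majda1984, Ch. 2 §2.1 Thm 2.2 (2.38)] -/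
theorem derivLevelEnergy_three_le (hζ : ContDiff ℝ ∞ ζ) {K : Set (ℝ × ℝ)}
    {c₀ c₁ Λ G : ℝ} (hc₀ : 0 < c₀) (hc₀₁ : c₀ ≤ c₁) (hΛ1 : 1 ≤ Λ) (hG0 : 0 ≤ G)
    (hwK : ∀ z ∈ K, (c₀ ≤ Acoef ζ z.1 z.2 ∧ Acoef ζ z.1 z.2 ≤ c₁) ∧ (c₀ ≤ z.1 ∧ z.1 ≤ c₁) ∧
      (c₀ ≤ Ccoef z.1 z.2 ∧ Ccoef z.1 z.2 ≤ c₁))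
    (hΛK : ∀ z ∈ K, |z.1| ≤ Λ ∧ |z.2| ≤ Λ ∧ |Acoef ζ z.1 z.2| ≤ Λ ∧
      |dR (Acoef ζ) z.1 z.2| ≤ Λ ∧ |dT (Acoef ζ) z.1 z.2| ≤ Λ ∧
      |Ccoef z.1 z.2| ≤ Λ ∧ |dR Ccoef z.1 z.2| ≤ Λ ∧ |dT Ccoef z.1 z.2| ≤ Λ ∧
      |ζ z.1| ≤ Λ ∧ |deriv ζ z.1| ≤ Λ ∧ |Dcoef ζ z.1 z.2| ≤ Λ)
    (hGK : ∀ w : List (Fin 3), w.length ≤ 3 → ∀ z ∈ K,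
      (∀ T ∈ FF w, |T.coeff z.1 z.2| ≤ G) ∧ (∀ k, ∀ T ∈ GG ζ k w, |T.coeff z.1 z.2| ≤ G) ∧
        (∀ T ∈ HH ζ w, |T.coeff z.1 z.2| ≤ G))
    {T : ℝ} (hT : 0 < T) {ρ ϑ : ℝ → UnitAddTorus (Fin 3) → ℝ}
    {u : ℝ → UnitAddTorus (Fin 3) → EuclideanSpace ℝ (Fin 3)}
    (h : IsPrimitiveEulerSolutionOn (EulerEOS.monatomicExcess ζ f) (Ico 0 T) ρ u ϑ)
    (hstate : ∀ t ∈ Ico 0 T, ∀ x, (ρ t x, ϑ t x) ∈ K)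
    (hC1 : ∀ t ∈ Ico 0 T, ∀ x, ‖u t x‖ ≤ Λ ∧ ∀ i, |partialDeriv i (ρ t) x| ≤ Λ ∧
      ‖partialDeriv i (u t) x‖ ≤ Λ ∧ |partialDeriv i (ϑ t) x| ≤ Λ) :
    ∀ t ∈ Ico 0 T, derivLevelEnergy ρ u ϑ 3 t ≤
      c₁ / c₀ * Real.exp ((12 * Λ ^ 3 + 18 * (12 * Λ ^ 3) ^ 2 + 273780 * (12 * Λ ^ 3) * G * Λ ^ 4) / c₀ * t) *
        derivLevelEnergy ρ u ϑ 3 0 := by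
  intro t₀ ht₀
  have hc₁ : 0 < c₁ := hc₀.trans_le hc₀₁
  have hΛ0 : 0 ≤ Λ := zero_le_one.trans hΛ1
  obtain ⟨L, hLdef⟩ : ∃ L : ℝ, L = 12 * Λ ^ 3 := ⟨_, rfl⟩
  have hL0 : 0 ≤ L := by rw [hLdef]; exact mul_nonneg (by norm_num) (pow_nonneg hΛ0 3)
  have hL18 : 0 ≤ L + 18 * L ^ 2 := add_nonneg hL0 (mul_nonneg (by norm_num) (sq_nonneg L))
  obtain ⟨κ, hκ⟩ : ∃ κ : ℝ, κ = 7020 * L * G * Λ ^ 4 := ⟨_, rfl⟩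
  have hκ0 : 0 ≤ κ := by rw [hκ]; positivity
  obtain ⟨Kr, hKr⟩ : ∃ Kr : ℝ,
      Kr = (12 * Λ ^ 3 + 18 * (12 * Λ ^ 3) ^ 2 + 273780 * (12 * Λ ^ 3) * G * Λ ^ 4) / c₀ := ⟨_, rfl⟩
  have hKrL : Kr = ((L + 18 * L ^ 2) + 39 * κ) / c₀ := by rw [hKr, hκ, hLdef]; ring
  have hKr0 : 0 ≤ Kr := by rw [hKrL]; positivity
  rw [← hKr]
  -- pointwise bounds along the solution
  have hKb : ∀ t ∈ Ico 0 T, ∀ y, |ρ t y| ≤ Λ ∧ |ϑ t y| ≤ Λ ∧ |Acoef ζ (ρ t y) (ϑ t y)| ≤ Λ ∧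
      |dR (Acoef ζ) (ρ t y) (ϑ t y)| ≤ Λ ∧ |dT (Acoef ζ) (ρ t y) (ϑ t y)| ≤ Λ ∧
      |Ccoef (ρ t y) (ϑ t y)| ≤ Λ ∧ |dR Ccoef (ρ t y) (ϑ t y)| ≤ Λ ∧ |dT Ccoef (ρ t y) (ϑ t y)| ≤ Λ ∧
      |ζ (ρ t y)| ≤ Λ ∧ |deriv ζ (ρ t y)| ≤ Λ ∧ |Dcoef ζ (ρ t y) (ϑ t y)| ≤ Λ := fun t ht y =>
    hΛK _ (hstate t ht y)
  have hMb := hC1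
  have hφs : ∀ t ∈ Ico 0 T, ∀ k, IsSmooth (primFields ρ u ϑ t k) := fun t ht => isSmooth_primFields h ht
  have hlow : ∀ t ∈ Ico 0 T, ∀ (k : PIdx) (v : List (Fin 3)), v.length ≤ 1 → ∀ x,
      |iterPartialDeriv v (primFields ρ u ϑ t k) x| ≤ Λ := by
    intro t ht k v hv x
    have hu1 : IsContDiff 1 (u t) := (h.smooth_velocity.isSmooth_slice ht).isContDiff (by simp)
    rcases list_length_le_one hv with rfl | ⟨i, rfl⟩
    · rcases k with _ | _ | k
      · exact (hKb t ht x).1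
      · exact (hKb t ht x).2.1
      · simp only [iterPartialDeriv_nil, primFields]
        exact (abs_apply_le_norm _ _).trans (hMb t ht x).1
    · rcases k with _ | _ | k
      · simpa using ((hMb t ht x).2 i).1
      · simpa using ((hMb t ht x).2 i).2.2
      · simp only [iterPartialDeriv_cons, iterPartialDeriv_nil, primFields]
        rw [partialDeriv_apply_coord hu1]
        exact (abs_apply_le_norm _ _).trans ((hMb t ht x).2 i).2.1
  obtain ⟨δ, hδdef⟩ : ∃ δ : ℝ, δ = c₁ * derivLevelEnergy ρ u ϑ 3 0 := ⟨_, rfl⟩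
  -- the sub-interval `[0, τ]`
  let τ : ℝ := max t₀ (T / 2)
  have hτ : 0 < τ := lt_max_of_lt_right (half_pos hT)
  have hτT : τ < T := max_lt ht₀.2 (half_lt_self hT)
  have ht₀τ : t₀ ∈ Icc 0 τ := ⟨ht₀.1, le_max_left _ _⟩
  have hsub : Icc 0 τ ⊆ Ico 0 T := Icc_subset_Ico_right hτT
  have hsol := h.restrict_Icc hτ hτT
  have hSτ : UniqueDiffOn ℝ (Icc 0 τ) := uniqueDiffOn_Icc hτ
  -- the function and its derivative
  let g : ℝ → ℝ := weightedDerivLevelEnergy ζ ρ u ϑ 3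
  have hgdef : g = weightedDerivLevelEnergy ζ ρ u ϑ 3 := rfl
  let D : List (Fin 3) → ℝ → ℝ := fun w t => ∫ y, timeDerivWithin (Icc 0 τ)
    (fun s y => Acoef ζ (ρ s y) (ϑ s y) * iterPartialDeriv w (ρ s) y ^ 2 +
      ρ s y * (∑ k, iterPartialDeriv w (fun y => u s y k) y ^ 2) +
      Ccoef (ρ s y) (ϑ s y) * iterPartialDeriv w (ϑ s) y ^ 2) t y
  let g' : ℝ → ℝ := fun t => ∑ n ∈ Finset.Icc 1 3, ∑ w : Fin n → Fin 3, D (List.ofFn w) t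
  have hderiv : ∀ t ∈ Icc 0 τ, HasDerivWithinAt g (g' t) (Icc 0 τ) t := fun t ht =>
    HasDerivWithinAt.fun_sum fun n _ => HasDerivWithinAt.fun_sum fun w _ =>
      hasDerivWithinAt_weightedWordEnergy hζ hSτ (convex_Icc 0 τ) hsol (List.ofFn w) ht
  have hcont : ContinuousOn g (Icc 0 τ) := fun t ht => (hderiv t ht).continuousWithinAt
  have hderiv' : ∀ t ∈ Ico 0 τ, HasDerivWithinAt g (g' t) (Ici t) t := fun t ht =>
    (hderiv t (Ico_subset_Icc_self ht)).mono_of_mem_nhdsWithin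
      (mem_of_superset (Icc_mem_nhdsGE ht.2) (Icc_subset_Icc ht.1 le_rfl))
  -- comparison `c₀ D₃ ≤ g ≤ c₁ D₃` on `[0, τ]`
  have hwS : ∀ t ∈ Icc 0 τ, ∀ y, (c₀ ≤ Acoef ζ (ρ t y) (ϑ t y) ∧ Acoef ζ (ρ t y) (ϑ t y) ≤ c₁) ∧
      (c₀ ≤ ρ t y ∧ ρ t y ≤ c₁) ∧ (c₀ ≤ Ccoef (ρ t y) (ϑ t y) ∧ Ccoef (ρ t y) (ϑ t y) ≤ c₁) := fun t ht y =>
    hwK _ (hstate t (hsub ht) y)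
  have hcmp : ∀ t ∈ Icc 0 τ, c₀ * derivLevelEnergy ρ u ϑ 3 t ≤ g t ∧ g t ≤ c₁ * derivLevelEnergy ρ u ϑ 3 t := by
    intro t ht
    simp only [hgdef, weightedDerivLevelEnergy, derivLevelEnergy, Finset.mul_sum]
    exact ⟨Finset.sum_le_sum fun n _ => Finset.sum_le_sum fun w _ =>
        (weightedWordEnergy_compare hζ hsol hwS (List.ofFn w) ht).1,
      Finset.sum_le_sum fun n _ => Finset.sum_le_sum fun w _ =>
        (weightedWordEnergy_compare hζ hsol hwS (List.ofFn w) ht).2⟩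
  have hgnn : ∀ t ∈ Icc 0 τ, 0 ≤ g t := fun t ht =>
    (mul_nonneg hc₀.le (derivLevelEnergy_nonneg _ _)).trans (hcmp t ht).1
  -- the bound on the derivative
  have hbound : ∀ t ∈ Ico 0 τ, ‖g' t‖ ≤ Kr * ‖g t‖ + 0 := by
    intro t ht
    have htc : t ∈ Icc 0 τ := Ico_subset_Icc_self ht
    have htT : t ∈ Ico 0 T := hsub htc
    obtain ⟨E, hEdef⟩ : ∃ E : ℝ, E = derivLevelEnergy ρ u ϑ 3 t := ⟨_, rfl⟩
    have hE0 : 0 ≤ E := by rw [hEdef]; exact derivLevelEnergy_nonneg _ _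
    obtain ⟨X, hXdef⟩ : ∃ X : ℝ, X = Real.sqrt E := ⟨_, rfl⟩
    have hX0 : 0 ≤ X := by rw [hXdef]; exact Real.sqrt_nonneg _
    have hXX : X * X = E := by rw [hXdef]; exact Real.mul_self_sqrt hE0
    have hφst := hφs t htT
    have hφq : ∀ x, (primFields ρ u ϑ t PIdx.rho x, primFields ρ u ϑ t PIdx.theta x) ∈ quadrant :=
      primFields_mem_quadrant h htT
    -- the level-`3` hypotheses at time `t`
    have hXb : ∀ (k : PIdx) (v : List (Fin 3)), 1 ≤ v.length → v.length ≤ 3 →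
        Real.sqrt (∫ x, iterPartialDeriv v (primFields ρ u ϑ t k) x ^ 2) ≤ X := fun k v hv1 hv => by
      rw [hXdef, hEdef]; exact sqrt_integral_sq_primFields_le hv1 hv t k
    obtain ⟨Q, hQdef⟩ : ∃ Q : ℝ, Q = 702 * G * Λ ^ 4 * X := ⟨_, rfl⟩
    have hQ0 : 0 ≤ Q := by rw [hQdef]; positivity
    have hXQ : X * Q = 702 * G * Λ ^ 4 * E := by
      rw [hQdef, ← hXX]; ring
    -- the homogeneous list bound, for lists of at most `234` level-`n` monomials
    have hlist : ∀ (n : ℕ), n ≤ 3 → ∀ (Lst : List (DiffMonomial (Fin 3) PIdx)), Lst.length ≤ 234 →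
        (∀ T ∈ Lst, T.Proper ∧ 2 ≤ T.width ∧ T.width ≤ n + 1 ∧ T.order = n + 1 ∧ T.maxOrder ≤ n ∧
          ContDiffOn ℝ ∞ (uncurry T.coeff) quadrant) →
        (∀ T ∈ Lst, ∀ x, |T.coeff (primFields ρ u ϑ t PIdx.rho x) (primFields ρ u ϑ t PIdx.theta x)| ≤ G) →
        Real.sqrt (∫ x, ((Lst.map fun T => T.eval (primFields ρ u ϑ t) PIdx.rho PIdx.theta x).sum) ^ 2) ≤ Q := by
      intro n hn3 Lst hL hsh hGL
      have h1 := sqrt_integral_list_eval_sq_le_of_le_three hφst hφq hn3 hG0 hΛ1 hX0 (hlow t htT)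
        (fun k v hv1 hv => hXb k v hv1 (hv.trans hn3)) Lst hsh hGL
      refine h1.trans ?_
      have hpow : Λ ^ (n + 1) ≤ Λ ^ 4 := pow_le_pow_right₀ hΛ1 (by omega)
      have hlen' : (Lst.length : ℝ) ≤ 234 := by exact_mod_cast hL
      calc (Lst.length : ℝ) * (3 * G * Λ ^ (n + 1) * X) ≤ 234 * (3 * G * Λ ^ 4 * X) :=
            mul_le_mul hlen' (mul_le_mul_of_nonneg_right (mul_le_mul_of_nonneg_left hpow (by positivity)) hX0)
              (by positivity) (by norm_num)
        _ = Q := by rw [hQdef]; ring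
    -- the per-word bound
    have hword : ∀ (n : ℕ) (w : Fin n → Fin 3), 1 ≤ n → n ≤ 3 →
        |D (List.ofFn w) t| ≤ (L + 18 * L ^ 2) * wordEnergy ρ u ϑ (List.ofFn w) t + κ * E := by
      intro n w hn1 hn3
      have hlen : (List.ofFn w).length = n := List.length_ofFn
      have hlen3 : (List.ofFn w).length ≤ 3 := by rw [hlen]; exact hn3
      have hlen1 : 1 ≤ (List.ofFn w).length := by rw [hlen]; exact hn1
      have key := abs_integral_timeDerivWithin_weighted_le hζ hτ hsol hΛ1 (fun s hs y => hKb s (hsub hs) y)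
        (fun s hs y => hMb s (hsub hs) y) (List.ofFn w) htc
      -- coefficient bounds along the fields
      have hGF : ∀ T ∈ FF (List.ofFn w), ∀ x,
          |T.coeff (primFields ρ u ϑ t PIdx.rho x) (primFields ρ u ϑ t PIdx.theta x)| ≤ G := fun T hT x =>
        (hGK _ hlen3 _ (hstate t htT x)).1 T hT
      have hGG : ∀ k, ∀ T ∈ GG ζ k (List.ofFn w), ∀ x,
          |T.coeff (primFields ρ u ϑ t PIdx.rho x) (primFields ρ u ϑ t PIdx.theta x)| ≤ G := fun k T hT x =>
        (hGK _ hlen3 _ (hstate t htT x)).2.1 k T hT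
      have hGH : ∀ T ∈ HH ζ (List.ofFn w), ∀ x,
          |T.coeff (primFields ρ u ϑ t PIdx.rho x) (primFields ρ u ϑ t PIdx.theta x)| ≤ G := fun T hT x =>
        (hGK _ hlen3 _ (hstate t htT x)).2.2 T hT
      -- shapes
      have shapeF : ∀ T ∈ FF (List.ofFn w), T.Proper ∧ 2 ≤ T.width ∧ T.width ≤ n + 1 ∧
          T.order = n + 1 ∧ T.maxOrder ≤ n ∧ ContDiffOn ℝ ∞ (uncurry T.coeff) quadrant := fun T hT => by
        have := mem_FF (List.ofFn w) hT; rwa [hlen] at this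
      have shapeG : ∀ k, ∀ T ∈ GG ζ k (List.ofFn w), T.Proper ∧ 2 ≤ T.width ∧ T.width ≤ n + 1 ∧
          T.order = n + 1 ∧ T.maxOrder ≤ n ∧ ContDiffOn ℝ ∞ (uncurry T.coeff) quadrant := fun k T hT => by
        have := mem_GG hζ k (List.ofFn w) hT; rwa [hlen] at this
      have shapeH : ∀ T ∈ HH ζ (List.ofFn w), T.Proper ∧ 2 ≤ T.width ∧ T.width ≤ n + 1 ∧
          T.order = n + 1 ∧ T.maxOrder ≤ n ∧ ContDiffOn ℝ ∞ (uncurry T.coeff) quadrant := fun T hT => by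
        have := mem_HH hζ (List.ofFn w) hT; rwa [hlen] at this
      have hF := hlist n hn3 _ (length_FF_le hlen3) shapeF hGF
      have hG' : ∀ k, _ := fun k => hlist n hn3 _ (length_GG_le hζ k hlen3) (shapeG k) (hGG k)
      have hH := hlist n hn3 _ (length_HH_le hζ hlen3) shapeH hGH
      -- the three norms of `∂^w` fields are `≤ X`
      have nR : Real.sqrt (∫ y, iterPartialDeriv (List.ofFn w) (ρ t) y ^ 2) ≤ X := hXb PIdx.rho _ hlen1 hlen3
      have nΘ : Real.sqrt (∫ y, iterPartialDeriv (List.ofFn w) (ϑ t) y ^ 2) ≤ X := hXb PIdx.theta _ hlen1 hlen3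
      have nU : ∀ k, Real.sqrt (∫ y, iterPartialDeriv (List.ofFn w) (fun y => u t y k) y ^ 2) ≤ X := fun k =>
        hXb (PIdx.vel k) _ hlen1 hlen3
      have hsrc : Real.sqrt (∫ y, iterPartialDeriv (List.ofFn w) (ρ t) y ^ 2) *
            Real.sqrt (∫ y, ((FF (List.ofFn w)).map fun T => T.eval (primFields ρ u ϑ t) PIdx.rho PIdx.theta y).sum ^ 2) +
          (∑ k, Real.sqrt (∫ y, iterPartialDeriv (List.ofFn w) (fun y => u t y k) y ^ 2) *
            Real.sqrt (∫ y, ((GG ζ k (List.ofFn w)).map fun T => T.eval (primFields ρ u ϑ t) PIdx.rho PIdx.theta y).sum ^ 2)) +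
          Real.sqrt (∫ y, iterPartialDeriv (List.ofFn w) (ϑ t) y ^ 2) *
            Real.sqrt (∫ y, ((HH ζ (List.ofFn w)).map fun T => T.eval (primFields ρ u ϑ t) PIdx.rho PIdx.theta y).sum ^ 2)
          ≤ 5 * (X * Q) := by
        have h1 : _ ≤ X * Q := mul_le_mul nR hF (Real.sqrt_nonneg _) hX0
        have h3 : _ ≤ X * Q := mul_le_mul nΘ hH (Real.sqrt_nonneg _) hX0
        have h2 : ∀ k, _ ≤ X * Q := fun k => mul_le_mul (nU k) (hG' k) (Real.sqrt_nonneg _) hX0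
        have h2s : (∑ k, Real.sqrt (∫ y, iterPartialDeriv (List.ofFn w) (fun y => u t y k) y ^ 2) *
            Real.sqrt (∫ y, ((GG ζ k (List.ofFn w)).map fun T => T.eval (primFields ρ u ϑ t) PIdx.rho PIdx.theta y).sum ^ 2))
            ≤ ∑ _k : Fin 3, X * Q := Finset.sum_le_sum fun k _ => h2 k
        simp only [Finset.sum_const, Finset.card_univ, Fintype.card_fin, nsmul_eq_mul, Nat.cast_ofNat] at h2s
        calc _ ≤ X * Q + 3 * (X * Q) + X * Q := add_le_add (add_le_add h1 h2s) h3
          _ = 5 * (X * Q) := by ring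
      have key' : |D (List.ofFn w) t| ≤ (L + 18 * L ^ 2) * wordEnergy ρ u ϑ (List.ofFn w) t + 2 * L *
          (Real.sqrt (∫ y, iterPartialDeriv (List.ofFn w) (ρ t) y ^ 2) *
            Real.sqrt (∫ y, ((FF (List.ofFn w)).map fun T => T.eval (primFields ρ u ϑ t) PIdx.rho PIdx.theta y).sum ^ 2) +
          (∑ k, Real.sqrt (∫ y, iterPartialDeriv (List.ofFn w) (fun y => u t y k) y ^ 2) *
            Real.sqrt (∫ y, ((GG ζ k (List.ofFn w)).map fun T => T.eval (primFields ρ u ϑ t) PIdx.rho PIdx.theta y).sum ^ 2)) +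
          Real.sqrt (∫ y, iterPartialDeriv (List.ofFn w) (ϑ t) y ^ 2) *
            Real.sqrt (∫ y, ((HH ζ (List.ofFn w)).map fun T => T.eval (primFields ρ u ϑ t) PIdx.rho PIdx.theta y).sum ^ 2)) := by
        rw [← hLdef] at key
        exact key
      calc |D (List.ofFn w) t| ≤ (L + 18 * L ^ 2) * wordEnergy ρ u ϑ (List.ofFn w) t + 2 * L * (5 * (X * Q)) :=
            key'.trans (add_le_add le_rfl (mul_le_mul_of_nonneg_left hsrc (mul_nonneg zero_le_two hL0)))
        _ = (L + 18 * L ^ 2) * wordEnergy ρ u ϑ (List.ofFn w) t + κ * E := by rw [hXQ, hκ]; ring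
    -- sum over the words
    have hsumD : |g' t| ≤ (L + 18 * L ^ 2) * E + κ * E * 39 := by
      show |∑ n ∈ Finset.Icc 1 3, ∑ w : Fin n → Fin 3, D (List.ofFn w) t| ≤ _
      calc |∑ n ∈ Finset.Icc 1 3, ∑ w : Fin n → Fin 3, D (List.ofFn w) t|
          ≤ ∑ n ∈ Finset.Icc 1 3, ∑ w : Fin n → Fin 3, |D (List.ofFn w) t| :=
            (Finset.abs_sum_le_sum_abs _ _).trans (Finset.sum_le_sum fun n _ => Finset.abs_sum_le_sum_abs _ _)
        _ ≤ ∑ n ∈ Finset.Icc 1 3, ∑ w : Fin n → Fin 3,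
            ((L + 18 * L ^ 2) * wordEnergy ρ u ϑ (List.ofFn w) t + κ * E) :=
            Finset.sum_le_sum fun n hn => Finset.sum_le_sum fun w _ =>
              hword n w (Finset.mem_Icc.1 hn).1 (Finset.mem_Icc.1 hn).2
        _ = ∑ n ∈ Finset.Icc 1 3, ((L + 18 * L ^ 2) * (∑ w : Fin n → Fin 3, wordEnergy ρ u ϑ (List.ofFn w) t) +
            κ * E * ((Finset.univ : Finset (Fin n → Fin 3)).card : ℝ)) := by
            refine Finset.sum_congr rfl fun n _ => ?_
            rw [Finset.sum_add_distrib, Finset.sum_const, nsmul_eq_mul, ← Finset.mul_sum,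
              mul_comm ((Finset.univ : Finset (Fin n → Fin 3)).card : ℝ)]
        _ = (L + 18 * L ^ 2) * E + κ * E * 39 := by
            rw [Finset.sum_add_distrib, ← Finset.mul_sum, ← Finset.mul_sum, sum_card_words_Icc_one_three]
            simp only [hEdef, derivLevelEnergy]
    have hEg : c₀ * E ≤ g t := by rw [hEdef]; exact (hcmp t htc).1
    rw [Real.norm_eq_abs, Real.norm_eq_abs, abs_of_nonneg (hgnn t htc), add_zero]
    calc |g' t| ≤ (L + 18 * L ^ 2) * E + κ * E * 39 := hsumD
      _ = Kr * (c₀ * E) := by rw [hKrL]; field_simp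
      _ ≤ Kr * g t := mul_le_mul_of_nonneg_left hEg hKr0
  -- Grönwall on `[0, τ]` (with `ε = 0`) and the conclusion at `t₀`
  have h0τ : (0 : ℝ) ∈ Icc 0 τ := ⟨le_rfl, hτ.le⟩
  have hg0δ : ‖g 0‖ ≤ δ := by
    rw [Real.norm_eq_abs, abs_of_nonneg (hgnn 0 h0τ), hδdef]; exact (hcmp 0 h0τ).2
  have hgron := norm_le_gronwallBound_of_norm_deriv_right_le hcont hderiv' hg0δ hbound t₀ ht₀τ
  rw [gronwallBound_ε0, Real.norm_eq_abs, abs_of_nonneg (hgnn t₀ ht₀τ), sub_zero, hδdef] at hgron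
  have hfin : c₀ * derivLevelEnergy ρ u ϑ 3 t₀ ≤ c₁ * derivLevelEnergy ρ u ϑ 3 0 * Real.exp (Kr * t₀) :=
    ((hcmp t₀ ht₀τ).1).trans hgron
  calc derivLevelEnergy ρ u ϑ 3 t₀ = (c₀ * derivLevelEnergy ρ u ϑ 3 t₀) / c₀ := by field_simp
    _ ≤ (c₁ * derivLevelEnergy ρ u ϑ 3 0 * Real.exp (Kr * t₀)) / c₀ := div_le_div_of_nonneg_right hfin hc₀.le
    _ = c₁ / c₀ * Real.exp (Kr * t₀) * derivLevelEnergy ρ u ϑ 3 0 := by ring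

/-- **Time-uniform form on horizons `T ≤ 1`**: under the hypotheses of
`derivLevelEnergy_three_le`, `D₃(t) ≤ (c₁/c₀) exp(K_r) D₃(0)` for all `t ∈ [0, T)`, with the
same explicit rate `K_r = (12Λ³ + 18(12Λ³)² + 273780 · 12Λ³ · G · Λ⁴)/c₀` — a constant depending
only on `(c₀, c₁, Λ, G)`. [cite: Majda1984, Ch. 2 §2.1 Thm 2.2 (2.38)] -/
theorem derivLevelEnergy_three_le_of_le_one (hζ : ContDiff ℝ ∞ ζ) {K : Set (ℝ × ℝ)}
    {c₀ c₁ Λ G : ℝ} (hc₀ : 0 < c₀) (hc₀₁ : c₀ ≤ c₁) (hΛ1 : 1 ≤ Λ) (hG0 : 0 ≤ G)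
    (hwK : ∀ z ∈ K, (c₀ ≤ Acoef ζ z.1 z.2 ∧ Acoef ζ z.1 z.2 ≤ c₁) ∧ (c₀ ≤ z.1 ∧ z.1 ≤ c₁) ∧
      (c₀ ≤ Ccoef z.1 z.2 ∧ Ccoef z.1 z.2 ≤ c₁))
    (hΛK : ∀ z ∈ K, |z.1| ≤ Λ ∧ |z.2| ≤ Λ ∧ |Acoef ζ z.1 z.2| ≤ Λ ∧
      |dR (Acoef ζ) z.1 z.2| ≤ Λ ∧ |dT (Acoef ζ) z.1 z.2| ≤ Λ ∧
      |Ccoef z.1 z.2| ≤ Λ ∧ |dR Ccoef z.1 z.2| ≤ Λ ∧ |dT Ccoef z.1 z.2| ≤ Λ ∧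
      |ζ z.1| ≤ Λ ∧ |deriv ζ z.1| ≤ Λ ∧ |Dcoef ζ z.1 z.2| ≤ Λ)
    (hGK : ∀ w : List (Fin 3), w.length ≤ 3 → ∀ z ∈ K,
      (∀ T ∈ FF w, |T.coeff z.1 z.2| ≤ G) ∧ (∀ k, ∀ T ∈ GG ζ k w, |T.coeff z.1 z.2| ≤ G) ∧
        (∀ T ∈ HH ζ w, |T.coeff z.1 z.2| ≤ G))
    {T : ℝ} (hT : 0 < T) (hT1 : T ≤ 1) {ρ ϑ : ℝ → UnitAddTorus (Fin 3) → ℝ}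
    {u : ℝ → UnitAddTorus (Fin 3) → EuclideanSpace ℝ (Fin 3)}
    (h : IsPrimitiveEulerSolutionOn (EulerEOS.monatomicExcess ζ f) (Ico 0 T) ρ u ϑ)
    (hstate : ∀ t ∈ Ico 0 T, ∀ x, (ρ t x, ϑ t x) ∈ K)
    (hC1 : ∀ t ∈ Ico 0 T, ∀ x, ‖u t x‖ ≤ Λ ∧ ∀ i, |partialDeriv i (ρ t) x| ≤ Λ ∧
      ‖partialDeriv i (u t) x‖ ≤ Λ ∧ |partialDeriv i (ϑ t) x| ≤ Λ) :
    ∀ t ∈ Ico 0 T, derivLevelEnergy ρ u ϑ 3 t ≤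
      c₁ / c₀ * Real.exp ((12 * Λ ^ 3 + 18 * (12 * Λ ^ 3) ^ 2 + 273780 * (12 * Λ ^ 3) * G * Λ ^ 4) / c₀) *
        derivLevelEnergy ρ u ϑ 3 0 := by
  intro t ht
  have hmain := derivLevelEnergy_three_le hζ hc₀ hc₀₁ hΛ1 hG0 hwK hΛK hGK hT h hstate hC1 t ht
  refine hmain.trans (mul_le_mul_of_nonneg_right (mul_le_mul_of_nonneg_left ?_ ?_) (derivLevelEnergy_nonneg _ _))
  · refine Real.exp_le_exp.2 ?_
    have hKr0 : 0 ≤ (12 * Λ ^ 3 + 18 * (12 * Λ ^ 3) ^ 2 + 273780 * (12 * Λ ^ 3) * G * Λ ^ 4) / c₀ := by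
      have hΛ0 : 0 ≤ Λ := zero_le_one.trans hΛ1
      positivity
    have ht1 : t ≤ 1 := (ht.2.le).trans hT1
    nlinarith
  · exact div_nonneg (hc₀.le.trans hc₀₁) hc₀.le

end CompressibleEuler

end Literature.Analysis.FluidPDE

end
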